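/-
Copyright: derived here (Resolution Observatory cell `pub-rosobs`, carver gen 58). AI-written Lean; AI review is weaker than expert
review.  Engine 1's THEOREM R (THEOREM-LT-eng1-g38 §4; carver target T60) for the cell's POLYNOMIAL weighted-centre model `W(f)`, typed
as PURE LOGIC over the bootstrap frame of `WeightedCentreBootstrap`.  Instrument — NOT a resolution theorem and NOT a statement about the
invariant of [AbramovichTemkinWlodarczyk2024]; no algebra is done here.
-/
import Literature.AlgebraicGeometry.Resolution.WeightedCentreBootstrap
import Mathlib.Tactic.FieldSimp
import Mathlib.Tactic.Ring
import HarnessLib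

/-!
# THEOREM R over the bootstrap frame: `(E) ∧ FC ∧ (IT + ND0 + LT) ⇒ PURE⁺(ρ)` for every `ρ > 1/(p(p+1))` (T60, pure logic)

Uniform value line: INSTRUMENT — the structure-level implication of engine 1's THEOREM R (THEOREM-LT-eng1-g38 §4, "no `(P)`-system has
degree `ρ > 1/(p(p+1))`") in the cell's polynomial weighted-centre model `W(f)`, over the abstract `SystemFrame` of `WeightedCentreBootstrap`;
NOT a resolution theorem, NOT a statement about the Abramovich–Temkin–Włodarczyk invariant, NOT summit progress, and NOT a proof of the
algebraic inputs (LEMMA FC, LEMMA IT, ND0, THEOREM LT, T9 (E), ABSORBER, (KILL)), which enter as NAMED HYPOTHESES exactly as in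
`WeightedCentreBootstrap`; AI-written Lean, AI review is weaker than expert review.

## Dictionary (THEOREM-LT §4 ↔ this file)

The notes: "By (B⁺) with `ρ₁ := 1/(p(p+1))` it suffices to show PURE⁺(ρ) for every `ρ > ρ₁`, and PURE⁺(ρ) holds as soon as NO `(P)`-system
of degree `ρ` with a pure term satisfies (H1), (H>), (Hmax), (R0).  Let `S` be one.  (FC): `j* = p^{e′}`, `e′ ≥ 1` (ND0).  Since
`w* = p^{e′}ρ ≤ 1/2` … `e′ = 1` because `p²ρ > p/(p+1) > 1/2`.  So `j* = p`, `w* = pρ`, and (IT) provides `D` … Apply THEOREM LT: `w_min ≥ w* = pρ`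
by (R0), so every class of weight `u ≥ w_min + ρ` has `u ≥ (p+1)ρ > 1/p`, and `u > pρ > ρ > η`.  Hence `D = 0` — contradiction."

* `SystemFrame.RLaws F p` = `LawsPlus` (BOOTSTRAP⁺'s inputs) + three identity-level fields:
  `pure_weight_le_half` (T9 (E): the lightest pure weight `w* = j*·ρ` is `≤ 1/2`), `fc` (LEMMA FC with ND0: under (H1), (H>), (Hmax) the
  lightest pure exponent is `p^e`, `e ≥ 1`), and `lt_step` (LEMMA IT + ND0 + THEOREM LT bundled: a `(P)`-system with a pure term, (R0) and
  `j* = p` is impossible once `(p+1)ρ > 1/p` — IT gives `D ≠ 0`, graded of degree `−ρ`, without constants, `D g = 0`; (R0) gives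
  `w_min ≥ pρ`; LT kills `D`).  `lt_step_of_it_lt` assembles `lt_step` from separate IT and LT hypotheses over any predicate "carries a
  kernel derivation".
* **`PUREplus_of_RLaws`**: `RLaws F p`, `p ≥ 2` ⇒ `PURE⁺(ρ)` for every `ρ > 1/(p(p+1))` (the displayed paragraph; the arithmetic `e′ = 1` and
  `(p+1)ρ > 1/p` is done inline — cf. `LTKit.e_eq_one`, `LTKit.inv_lt_of_class_weight`, `BoundaryArith`).
* **`theoremR`**: `RLaws F p`, `p ≥ 2` ⇒ no `(P)`-system has degree `> 1/(p(p+1))` (`bootstrapPlus_Ioi` with `ρ₁ = 1/(p(p+1)) > 0`);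
  `deg_le_of_pinned` — the COROLLARY-I shape "`θ ≤ 1/(p(p+1))` for every isotropy of degree `> η` of a pinned configuration".

Where `p` odd / `q = p^e` enter: only inside the hypotheses (`gammaStep` of `Laws`, `fc`, `lt_step`); the frame sees a natural number
`p ≥ 2`.  NOT here: the boundary `ρ = 1/(p(p+1))` (PROPOSITION B, THEOREM B′/B″: `WeightedCentreBoundaryArith`, `WeightedCentreFrobeniusPin`,
`WeightedCentreTwoClassArith`), the instantiation of the frame by the `W(f)` model.

References: context [AbramovichTemkinWlodarczyk2024] Thm. 5.3.1 (2)–(3) (graded automorphisms of the graded algebra of a weighted centre —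
the "isotropies" abstracted by the frame); statements ours, elementary logic and `ℚ`-arithmetic.
-/

namespace Literature.AlgebraicGeometry.Resolution.WeightedBlowup

namespace SystemFrame

universe u

variable (F : SystemFrame.{u})

/-- The inputs of THEOREM R (THEOREM-LT-eng1-g38 §4; ours) over the bootstrap frame: BOOTSTRAP⁺'s laws, T9 (E), LEMMA FC (+ND0), and the
bundle LEMMA IT + ND0 + THEOREM LT.  [cite: AbramovichTemkinWlodarczyk2024, Thm. 5.3.1 (2)–(3) (p. 1578)] -/
structure RLaws (p : ℕ) : Prop extends LawsPlus F where
  /-- T9 (E): slot weights are `≤ 1/2`, so the lightest pure weight `w* = j*·ρ` of a `(P)`-system is `≤ 1/2`. -/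
  pure_weight_le_half : ∀ (η : ℚ) {C : F.Conf} (X : F.Iso C), F.PSystem η X → F.HasPure X →
    (F.lightExp X : ℚ) * F.deg X ≤ 1 / 2
  /-- LEMMA FC (with ND0): under (H1), (H>), (Hmax) the lightest pure exponent is a positive power of `p`. -/
  fc : ∀ (η : ℚ) {C : F.Conf} (X : F.Iso C), F.PSystem η X → F.HasPure X →
    F.H1 C (F.deg X) → F.Hgt C (F.deg X) → F.Hmax X → ∃ e : ℕ, 1 ≤ e ∧ F.lightExp X = p ^ e
  /-- LEMMA IT + ND0 + THEOREM LT: a `(P)`-system with a pure term, (R0) and `j* = p` cannot have `(p+1)·ρ > 1/p` (IT: `D = E₁ ≠ 0`, graded of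
  degree `−ρ`, without constants, `D g = 0`; (R0): `w_min ≥ pρ`, so the classes LT must linearise weigh `≥ (p+1)ρ > 1/p` and `> ρ > η`;
  LT: `D = 0`). -/
  lt_step : ∀ (η : ℚ) {C : F.Conf} (X : F.Iso C), F.PSystem η X → F.HasPure X → F.R0 X → F.lightExp X = p →
    1 / (p : ℚ) < (p + 1) * F.deg X → False

variable {F}

/-- Assembling `lt_step` from separate hypotheses IT ("`j* = p` with (R0) ⇒ a kernel derivation exists") and LT ("no kernel derivation
once `(p+1)ρ > 1/p`"), over any predicate `KerDer X` standing for "the configuration carries a non-zero graded derivation of degree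
`−deg X` without constants killing `g`" (ours, bookkeeping). [cite: AbramovichTemkinWlodarczyk2024, Thm. 5.3.1 (2)–(3) (p. 1578)] -/
theorem lt_step_of_it_lt {p : ℕ} (KerDer : ∀ ⦃C : F.Conf⦄, F.Iso C → Prop)
    (it : ∀ (η : ℚ) {C : F.Conf} (X : F.Iso C), F.PSystem η X → F.HasPure X → F.R0 X → F.lightExp X = p → KerDer X)
    (lt : ∀ (η : ℚ) {C : F.Conf} (X : F.Iso C), F.PSystem η X → F.R0 X → F.lightExp X = p → KerDer X →
      1 / (p : ℚ) < (p + 1) * F.deg X → False) :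
    ∀ (η : ℚ) {C : F.Conf} (X : F.Iso C), F.PSystem η X → F.HasPure X → F.R0 X → F.lightExp X = p →
      1 / (p : ℚ) < (p + 1) * F.deg X → False :=
  fun η _ X hX hpure hR0 hj hρ => lt η X hX hR0 hj (it η X hX hpure hR0 hj) hρ

/-- **THEOREM R, the pure-side step** (THEOREM-LT-eng1-g38 §4; ours): under `RLaws F p` with `p ≥ 2`, `PURE⁺(ρ)` holds for every
`ρ > 1/(p(p+1))` — vacuously: a `(P)`-system of degree `ρ` with a pure term and (H1), (H>), (Hmax), (R0) has `j* = p^e` with `p^e ρ ≤ 1/2`,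
forcing `e = 1` (`p²ρ > p/(p+1) ≥ … > 1/2`), and then `(p+1)ρ > 1/p` feeds `lt_step`.
[cite: AbramovichTemkinWlodarczyk2024, Thm. 5.3.1 (2)–(3) (p. 1578)] -/
theorem PUREplus_of_RLaws {p : ℕ} (hp : 2 ≤ p) (L : F.RLaws p) {ρ : ℚ} (hρ : 1 / ((p : ℚ) * (p + 1)) < ρ) : F.PUREplus ρ := by
  intro η C X hX hdeg hpure h1 hgt hmax hR0
  exfalso
  have hp' : (2 : ℚ) ≤ p := by exact_mod_cast hp
  have hp0 : (0 : ℚ) < p := by linarith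
  obtain ⟨e, he, hj⟩ := L.fc η X hX hpure (hdeg ▸ h1) (hdeg ▸ hgt) hmax
  have hw := L.pure_weight_le_half η X hX hpure
  rw [hj, hdeg] at hw
  push_cast at hw
  -- `ρ > 1/(p(p+1))` gives `p² ρ > p/(p+1) ≥ 2/3 > 1/2`, so `e = 1`
  have hρ' : (p : ℚ) * (p + 1) * ρ > 1 := by
    have hpos : (0 : ℚ) < (p : ℚ) * (p + 1) := by positivity
    have := mul_lt_mul_of_pos_left hρ hpos
    rwa [mul_one_div_cancel hpos.ne'] at this
  have he1 : e = 1 := by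
    by_contra hne
    have he2 : 2 ≤ e := by omega
    have hpow : (p : ℚ) ^ 2 ≤ (p : ℚ) ^ e := pow_le_pow_right₀ (by linarith) he2
    have hρ0 : 0 < ρ := lt_trans (by positivity) hρ
    have h1 : (p : ℚ) ^ 2 * ρ ≤ 1 / 2 := le_trans (mul_le_mul_of_nonneg_right hpow hρ0.le) hw
    -- `p² ρ = p(p+1)ρ · p/(p+1)`-free form: `p² ρ ≥ p(p+1)ρ − pρ` and `pρ ≤ p²ρ/2`
    nlinarith
  subst he1
  rw [pow_one] at hj
  refine L.lt_step η X hX hpure hR0 hj ?_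
  rw [hdeg, div_lt_iff₀ hp0]
  nlinarith

/-- **THEOREM R over the frame** (THEOREM-LT-eng1-g38 §4 "No `(P)`-system has degree `ρ > 1/(p(p+1))`"; ours): `RLaws F p`, `p ≥ 2` ⇒
no `(P)`-system (any threshold `η`) has degree `> 1/(p(p+1))`.  [`bootstrapPlus_Ioi` with `ρ₁ = 1/(p(p+1)) > 0` and `PUREplus_of_RLaws`.]
[cite: AbramovichTemkinWlodarczyk2024, Thm. 5.3.1 (2)–(3) (p. 1578)] -/
theorem theoremR {p : ℕ} (hp : 2 ≤ p) (L : F.RLaws p) (η : ℚ) (C : F.Conf) (X : F.Iso C) (hX : F.PSystem η X) :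
    ¬ 1 / ((p : ℚ) * (p + 1)) < F.deg X := by
  have hp0 : (0 : ℚ) < p := by exact_mod_cast (lt_of_lt_of_le (by norm_num) hp)
  exact bootstrapPlus_Ioi L.toLawsPlus (by positivity) (fun ρ hρ => PUREplus_of_RLaws hp L hρ) η C X hX

/-- COROLLARY-I shape (ours): a configuration with `(P)` (threshold `η`) admits no non-trivial graded isotropy of degree `> max(η, 1/(p(p+1)))` —
in the model: every bent maximal centre has `θ ≤ 1/(p(p+1))` (or `θ = 1/q`). [cite: AbramovichTemkinWlodarczyk2024, Thm. 5.3.1 (2)–(3) (p. 1578)] -/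
theorem deg_le_of_pinned {p : ℕ} (hp : 2 ≤ p) (L : F.RLaws p) {η : ℚ} {C : F.Conf} (hC : F.Pinned η C) (X : F.Iso C)
    (hη : η < F.deg X) : F.deg X ≤ 1 / ((p : ℚ) * (p + 1)) :=
  le_of_not_gt (theoremR hp L η C X ⟨hC, hη⟩)

/-- The `q = p²` consequence in frame form (ours): if the threshold is `η = 1/p²` then, since `1/p² > 1/(p(p+1))`, a pinned configuration has NO
non-trivial graded isotropy of degree `> η` at all ("at `q = p²` no maximal centre is bent"). [cite: AbramovichTemkinWlodarczyk2024, Thm. 5.3.1 (2)–(3) (p. 1578)] -/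
theorem no_iso_at_p_sq {p : ℕ} (hp : 2 ≤ p) (L : F.RLaws p) {C : F.Conf} (hC : F.Pinned (1 / (p : ℚ) ^ 2) C) (X : F.Iso C) :
    ¬ 1 / (p : ℚ) ^ 2 < F.deg X := by
  intro hη
  have hle := deg_le_of_pinned hp L hC X hη
  have hp' : (2 : ℚ) ≤ p := by exact_mod_cast hp
  have hlt : 1 / ((p : ℚ) * (p + 1)) < 1 / (p : ℚ) ^ 2 := by
    rw [one_div_lt_one_div (by positivity) (by positivity)]
    nlinarith
  linarith

end SystemFrame

end Literature.AlgebraicGeometry.Resolution.WeightedBlowup
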